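import Summits.AtomisticToContinuum.Crystallization.Theorems.OverbindingBudgetAffineDualBesselLadder

/-!
# Dual Bessel kernel — pointwise box/tail bounds and the `ℚ` certificate kernel `DualRow.check`

g66 Deliverable B, part 2/3.  §K4: the dual Bessel term `dualBesselTerm μ d r = (π r/d)^μ K_μ(2π d r)` is bounded on a norm window
`rlo ≤ r ≤ rhi`, `d ≥ dlo` by the ladder at `y_lo = 2π⁻ dlo rlo` (`dualBesselTerm_le_box`), and in the tail `r ≥ κ L`, `L ≥ Z+1` by the
envelope times `e^{−δβ(L − (Z+1))}` (`dualBesselTerm_le_tail`); the Gram-trace inequality `⟪w,b₀⟫² + ⟪w,b₁⟫² ≤ ‖w‖²(g₀₀ + g₁₁)`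
feeds `‖w‖ ≥ κ|z|₁`.  §K5: ONE ROW `DualRow` = (order `μ`, rational Gram enclosures, `dlo`, box radius `Z` with per-point
witnesses `BoxPt = (z₀, z₁, rlo, rhi, N, s)`, tail data, claimed `bound`) and the Boolean certificate `DualRow.check`
(pure `ℚ` arithmetic, evaluated by `decide +kernel`; the majorant `GQ : ℤ² → ℚ` is the function both the kernel sums and the
soundness proof dominates with).  §K6a: summation helpers (`Σ_{ℤ} (1/2)^{|t|} = 3`, `Σ_{ℤ²} = 9`).  No `sorry`.
-/

noncomputable section

open Real Set Finset
open scoped BigOperators InnerProductSpace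

namespace Summit.AtomisticToContinuum.Crystallization.Theorems.OverbindingBudgetAffineFarSmoothSplit

open Literature.Analysis.FunctionSpaces Literature.Algebra.EuclideanLattices

/-! ## §K4 Pointwise bounds for the dual Bessel term `φ_{μ,d}(r) = (π r/d)^μ K_μ(2π d r)` -/

/-- The dual Bessel term of order `μ` at distance `d` and dual norm `r`. -/
def dualBesselTerm (μ : ℕ) (d r : ℝ) : ℝ := (π * r / d) ^ (μ : ℝ) * besselKReal μ (2 * π * d * r)

/-- `dualBesselTerm_eq_pow` (docstring added by the landing lane; see the module docstring). [formal bookkeeping] -/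
theorem dualBesselTerm_eq_pow (μ : ℕ) (d r : ℝ) : dualBesselTerm μ d r = (π * r / d) ^ μ * besselKReal μ (2 * π * d * r) := by
  rw [dualBesselTerm, Real.rpow_natCast]

/-- `dualBesselTerm_zero` (docstring added by the landing lane; see the module docstring). [formal bookkeeping] -/
theorem dualBesselTerm_zero {μ : ℕ} (hμ : μ ≠ 0) (d : ℝ) : dualBesselTerm μ d 0 = 0 := by
  rw [dualBesselTerm_eq_pow, mul_zero, zero_div, zero_pow hμ, zero_mul]

/-- `dualBesselTerm_nonneg` (docstring added by the landing lane; see the module docstring). [formal bookkeeping] -/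
theorem dualBesselTerm_nonneg (μ : ℕ) {d r : ℝ} (hd : 0 < d) (hr : 0 < r) : 0 ≤ dualBesselTerm μ d r := by
  rw [dualBesselTerm_eq_pow]
  exact mul_nonneg (by positivity) (besselKReal_pos _ (by positivity)).le

/-- ★ **Box bound**: `r_lo ≤ r ≤ r_hi`, `d_lo ≤ d` ⇒ `φ ≤ (π⁺ r_hi/d_lo)^μ · √(π/(2y_lo)) e^{−y_lo} ladder μ y_lo`, `y_lo = 2π⁻ d_lo r_lo`. [this file] -/
theorem dualBesselTerm_le_box (μ : ℕ) {d dlo r rlo rhi : ℝ} (hdlo : 0 < dlo) (hd : dlo ≤ d) (hrlo : 0 < rlo) (hr : rlo ≤ r) (hr' : r ≤ rhi) :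
    dualBesselTerm μ d r ≤ (((piHi : ℚ) : ℝ) * rhi / dlo) ^ μ *
      (Real.sqrt (π / (2 * (2 * ((piLo : ℚ) : ℝ) * dlo * rlo))) * Real.exp (-(2 * ((piLo : ℚ) : ℝ) * dlo * rlo)) *
        ladder μ (2 * ((piLo : ℚ) : ℝ) * dlo * rlo)) := by
  have hd0 : 0 < d := lt_of_lt_of_le hdlo hd
  have hr0 : 0 < r := lt_of_lt_of_le hrlo hr
  have hpl := piLo_lt_pi; have hph := pi_lt_piHi; have hpl0 := piLo_pos
  set yl : ℝ := 2 * ((piLo : ℚ) : ℝ) * dlo * rlo with hyl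
  have hyl0 : 0 < yl := by positivity
  have hy : yl ≤ 2 * π * d * r := by
    have h1 : ((piLo : ℚ) : ℝ) * dlo ≤ π * d := mul_le_mul hpl.le hd hdlo.le Real.pi_pos.le
    have h2 : ((piLo : ℚ) : ℝ) * dlo * rlo ≤ π * d * r := mul_le_mul h1 hr hrlo.le (by positivity)
    linarith
  rw [dualBesselTerm_eq_pow]
  have hrhi : 0 < rhi := lt_of_lt_of_le hr0 hr'
  have hph0 : (0:ℝ) < ((piHi : ℚ) : ℝ) := lt_trans Real.pi_pos hph
  refine mul_le_mul (pow_le_pow_left₀ (by positivity) ?_ μ) ((besselKReal_le_of_le hyl0 hy).trans (besselKReal_nat_le_ladder μ hyl0))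
    (besselKReal_pos _ (by positivity)).le (by positivity)
  -- `π r / d ≤ π⁺ r_hi / d_lo`
  rw [div_le_div_iff₀ hd0 hdlo]
  calc π * r * dlo ≤ ((piHi : ℚ) : ℝ) * rhi * dlo := by
        refine mul_le_mul_of_nonneg_right (mul_le_mul hph.le hr' hr0.le (by linarith [Real.pi_pos])) hdlo.le
    _ ≤ ((piHi : ℚ) : ℝ) * rhi * d := mul_le_mul_of_nonneg_left hd (by nlinarith [Real.pi_pos])

/-- ★ **Tail bound**: if `r ≥ κ L` with `L ≥ Z+1`, `d ≥ d_lo`, `β = 2π⁻ d_lo κ`, `y₁ = β (Z+1) > μ`, then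
`φ ≤ (2 d_lo²)^{−μ} · [√(π/(2y₁)) ladder μ y₁ y₁^μ e^{−y₁}] · e^{−(1 − μ/y₁) β (L − (Z+1))}`. [this file] -/
theorem dualBesselTerm_le_tail (μ : ℕ) {d dlo r κ L : ℝ} {Z : ℕ} (hdlo : 0 < dlo) (hd : dlo ≤ d) (hκ : 0 < κ) (hL : (Z : ℝ) + 1 ≤ L)
    (hr : κ * L ≤ r) (hμ : (μ : ℝ) < 2 * ((piLo : ℚ) : ℝ) * dlo * κ * ((Z : ℝ) + 1)) :
    dualBesselTerm μ d r ≤ (1 / (2 * dlo ^ 2)) ^ μ *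
      (Real.sqrt (π / (2 * (2 * ((piLo : ℚ) : ℝ) * dlo * κ * ((Z : ℝ) + 1)))) * ladder μ (2 * ((piLo : ℚ) : ℝ) * dlo * κ * ((Z : ℝ) + 1)) *
        (2 * ((piLo : ℚ) : ℝ) * dlo * κ * ((Z : ℝ) + 1)) ^ μ * Real.exp (-(2 * ((piLo : ℚ) : ℝ) * dlo * κ * ((Z : ℝ) + 1)))) *
      Real.exp (-(1 - μ / (2 * ((piLo : ℚ) : ℝ) * dlo * κ * ((Z : ℝ) + 1))) * (2 * ((piLo : ℚ) : ℝ) * dlo * κ) * (L - ((Z : ℝ) + 1))) := by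
  have hd0 : 0 < d := lt_of_lt_of_le hdlo hd
  have hpl := piLo_lt_pi; have hpl0 := piLo_pos
  have hL0 : 0 < L := by linarith [(Nat.cast_nonneg Z : (0:ℝ) ≤ Z)]
  have hr0 : 0 < r := lt_of_lt_of_le (mul_pos hκ hL0) hr
  set β : ℝ := 2 * ((piLo : ℚ) : ℝ) * dlo * κ with hβ
  set y₁ : ℝ := β * ((Z : ℝ) + 1) with hy₁
  have hβ0 : 0 < β := by positivity
  have hy₁0 : 0 < y₁ := by positivity
  set y : ℝ := 2 * π * d * r with hydef
  have hyL : β * L ≤ y := by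
    have h1 : ((piLo : ℚ) : ℝ) * dlo ≤ π * d := mul_le_mul hpl.le hd hdlo.le Real.pi_pos.le
    have h2 : ((piLo : ℚ) : ℝ) * dlo * (κ * L) ≤ π * d * r := mul_le_mul h1 hr (by positivity) (by positivity)
    rw [hβ, hydef]; linarith
  have hy : y₁ ≤ y := le_trans (mul_le_mul_of_nonneg_left hL hβ0.le) hyL
  have hy0 : 0 < y := lt_of_lt_of_le hy₁0 hy
  -- rewrite the term as `(2d²)^{−μ} · y^μ K_μ(y)`
  have hterm : dualBesselTerm μ d r = (1 / (2 * d ^ 2)) ^ μ * (y ^ μ * besselKReal μ y) := by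
    rw [dualBesselTerm_eq_pow, hydef, ← mul_assoc, ← mul_pow]; congr 2; field_simp
  rw [hterm]
  have hδ : 0 < 1 - μ / y₁ := by
    rw [sub_pos, div_lt_one hy₁0]; rw [hy₁, hβ]; linarith
  have henv := pow_mul_besselKReal_le_envelope μ hy₁0 hy
  have hmono : Real.exp (-(1 - μ / y₁) * (y - y₁)) ≤ Real.exp (-(1 - μ / y₁) * β * (L - ((Z : ℝ) + 1))) := by
    rw [Real.exp_le_exp]
    have : β * (L - ((Z : ℝ) + 1)) ≤ y - y₁ := by rw [hy₁]; linarith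
    nlinarith
  have hA : 0 ≤ Real.sqrt (π / (2 * y₁)) * ladder μ y₁ * y₁ ^ μ * Real.exp (-y₁) := by
    have := ladder_pos μ hy₁0; positivity
  calc (1 / (2 * d ^ 2)) ^ μ * (y ^ μ * besselKReal μ y)
      ≤ (1 / (2 * dlo ^ 2)) ^ μ * (Real.sqrt (π / (2 * y₁)) * ladder μ y₁ * y₁ ^ μ * Real.exp (-y₁) * Real.exp (-(1 - μ / y₁) * β * (L - ((Z : ℝ) + 1)))) := by
        refine mul_le_mul (pow_le_pow_left₀ (by positivity) ?_ μ) (henv.trans (mul_le_mul_of_nonneg_left hmono hA))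
          (mul_nonneg (by positivity) (besselKReal_pos _ hy0).le) (by positivity)
        exact div_le_div_of_nonneg_left zero_le_one (by positivity) (by nlinarith)
    _ = _ := by rw [hy₁, hβ]; ring

/-- `exp(−x (n : ℕ)) = (exp(−x))^n ≤ ρ^n` packaging for the tail: with `ρ ≤ 1/2`, `e^{−x n} ≤ 2^{Z+1} (1/2)^{n + (Z+1)}`-free form
`e^{−x·(L − (Z+1))} ≤ (1/2)^{L−(Z+1)}` for natural `L ≥ Z+1`. [folklore] -/
theorem exp_neg_mul_le_half_pow {x : ℝ} (hx : Real.exp (-x) ≤ 1 / 2) {L Z : ℕ} (hL : Z + 1 ≤ L) :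
    Real.exp (-x * ((L : ℝ) - ((Z : ℝ) + 1))) ≤ (1 / 2) ^ (L - (Z + 1)) := by
  have : (L : ℝ) - ((Z : ℝ) + 1) = ((L - (Z + 1) : ℕ) : ℝ) := by push_cast [Nat.cast_sub hL]; ring
  rw [this, mul_comm, Real.exp_nat_mul]
  exact pow_le_pow_left₀ (Real.exp_pos _).le hx _

/-- Lower bound on the dual norm from the Gram trace: in the plane, `‖w‖² (g₀₀ + g₁₁) ≥ ⟪w,b₀⟫² + ⟪w,b₁⟫²`
(`Q(z)(g₀₀+g₁₁) − det G ‖z‖² = (g₁₁z₀ − g₀₁z₁)² + (g₀₁z₀ − g₀₀z₁)² ≥ 0`). [folklore] -/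
theorem inner_sq_add_inner_sq_le {V : Type*} [NormedAddCommGroup V] [InnerProductSpace ℝ V] (b : Fin 2 → V) {w : V} (hw : w ∈ Submodule.span ℝ (Set.range b))
    (hD : 0 < ‖b 0‖ ^ 2 * ‖b 1‖ ^ 2 - ⟪b 0, b 1⟫_ℝ ^ 2) :
    ⟪w, b 0⟫_ℝ ^ 2 + ⟪w, b 1⟫_ℝ ^ 2 ≤ ‖w‖ ^ 2 * (‖b 0‖ ^ 2 + ‖b 1‖ ^ 2) := by
  have hid := norm_sq_mul_gramDet_eq b hw
  set D := ‖b 0‖ ^ 2 * ‖b 1‖ ^ 2 - ⟪b 0, b 1⟫_ℝ ^ 2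
  set z0 := ⟪w, b 0⟫_ℝ; set z1 := ⟪w, b 1⟫_ℝ
  have key : ‖w‖ ^ 2 * D * (‖b 0‖ ^ 2 + ‖b 1‖ ^ 2) - D * (z0 ^ 2 + z1 ^ 2) =
      (‖b 1‖ ^ 2 * z0 - ⟪b 0, b 1⟫_ℝ * z1) ^ 2 + (⟪b 0, b 1⟫_ℝ * z0 - ‖b 0‖ ^ 2 * z1) ^ 2 := by
    rw [hid]; ring
  have hnn : 0 ≤ ‖w‖ ^ 2 * D * (‖b 0‖ ^ 2 + ‖b 1‖ ^ 2) - D * (z0 ^ 2 + z1 ^ 2) := by rw [key]; positivity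
  have : D * (z0 ^ 2 + z1 ^ 2) ≤ D * (‖w‖ ^ 2 * (‖b 0‖ ^ 2 + ‖b 1‖ ^ 2)) := by linarith
  exact le_of_mul_le_mul_left this hD

/-! ## §K5 The dual Bessel KERNEL over `ℚ`: box witnesses + separable tail, and its certificate checks -/

/-- The symmetric integer range `[−Z, Z]` as a list. -/
def intRange (Z : ℕ) : List ℤ := (List.range (2 * Z + 1)).map fun n : ℕ => (n : ℤ) - (Z : ℤ)

/-- The box `[−Z, Z]²` as a list (contains `0`). -/
def boxPts (Z : ℕ) : List (ℤ × ℤ) := intRange Z ×ˢ intRange Z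

/-- `mem_intRange` (docstring added by the landing lane; see the module docstring). [formal bookkeeping] -/
theorem mem_intRange {Z : ℕ} {t : ℤ} : t ∈ intRange Z ↔ |t| ≤ Z := by
  simp only [intRange, List.mem_map, List.mem_range]
  constructor
  · rintro ⟨n, hn, rfl⟩; rw [abs_le]; constructor <;> omega
  · intro h; rw [abs_le] at h; exact ⟨(t + Z).toNat, by omega, by omega⟩

/-- `mem_boxPts` (docstring added by the landing lane; see the module docstring). [formal bookkeeping] -/
theorem mem_boxPts {Z : ℕ} {z : ℤ × ℤ} : z ∈ boxPts Z ↔ |z.1| ≤ Z ∧ |z.2| ≤ Z := by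
  rw [boxPts, show z = (z.1, z.2) from rfl, List.mem_product, mem_intRange, mem_intRange]

/-- `nodup_intRange` (docstring added by the landing lane; see the module docstring). [formal bookkeeping] -/
theorem nodup_intRange (Z : ℕ) : (intRange Z).Nodup :=
  List.nodup_range.map fun a b h => by simpa using h

/-- `nodup_boxPts` (docstring added by the landing lane; see the module docstring). [formal bookkeeping] -/
theorem nodup_boxPts (Z : ℕ) : (boxPts Z).Nodup := (nodup_intRange Z).product (nodup_intRange Z)

/-- A box witness: the integer point `(z0, z1)`, rational dual-norm witnesses `rlo ≤ ‖w_z‖ ≤ rhi`, the exponential floor `N ≤ y_lo`,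
and a square-root witness `s ≥ √(π⁺/(2 y_lo))`. -/
structure BoxPt where
  z0 : ℤ
  z1 : ℤ
  rlo : ℚ
  rhi : ℚ
  N : ℕ
  s : ℚ

/-- ONE ROW of the dual Bessel table: Bessel order `μ` (`= σ − 1 ≥ 1`), rational enclosures of the Gram matrix
`[[g₀₀, g₀₁], [g₀₁, g₁₁]]` of the layer lattice basis, a lower bound `dlo` of the layer distance, the box radius `Z` with its
witnesses, the tail data (`Thi ≥ g₀₀ + g₁₁`, `κ` with `2 Thi κ² ≤ 1`, exponential floors, a square-root witness) and the claimed bound. -/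
structure DualRow where
  μ : ℕ
  g00lo : ℚ
  g00hi : ℚ
  g01lo : ℚ
  g01hi : ℚ
  g11lo : ℚ
  g11hi : ℚ
  dlo : ℚ
  Z : ℕ
  pts : List BoxPt
  Thi : ℚ
  κ : ℚ
  Ntail : ℕ
  stail : ℚ
  Nrho : ℕ
  bound : ℚ

namespace DualRow

variable (R : DualRow)

/-- Lower / upper enclosures of `det G = g₀₀ g₁₁ − g₀₁²`. -/
def Dlo : ℚ := R.g00lo * R.g11lo - max (R.g01lo ^ 2) (R.g01hi ^ 2)
/-- `g01sqlo` (docstring added by the landing lane; see the module docstring). [formal bookkeeping] -/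
def g01sqlo : ℚ := if 0 ≤ R.g01lo then R.g01lo ^ 2 else if R.g01hi ≤ 0 then R.g01hi ^ 2 else 0
/-- `Dhi` (docstring added by the landing lane; see the module docstring). [formal bookkeeping] -/
def Dhi : ℚ := R.g00hi * R.g11hi - R.g01sqlo

/-- Enclosures of the adjugate form `Q(z) = g₁₁ z₀² − 2 g₀₁ z₀ z₁ + g₀₀ z₁²`. -/
def Qlo (z : ℤ × ℤ) : ℚ :=
  R.g11lo * (z.1 : ℚ) ^ 2 + min (-2 * (z.1 : ℚ) * z.2 * R.g01lo) (-2 * (z.1 : ℚ) * z.2 * R.g01hi) + R.g00lo * (z.2 : ℚ) ^ 2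
/-- `Qhi` (docstring added by the landing lane; see the module docstring). [formal bookkeeping] -/
def Qhi (z : ℤ × ℤ) : ℚ :=
  R.g11hi * (z.1 : ℚ) ^ 2 + max (-2 * (z.1 : ℚ) * z.2 * R.g01lo) (-2 * (z.1 : ℚ) * z.2 * R.g01hi) + R.g00hi * (z.2 : ℚ) ^ 2

/-- `y_lo = 2π⁻ dlo rlo` and the box term `(π⁺ rhi/dlo)^μ · s · expUB N y_lo · ladder μ y_lo`. -/
def ylo (e : BoxPt) : ℚ := 2 * piLo * R.dlo * e.rlo
/-- `boxTerm` (docstring added by the landing lane; see the module docstring). [formal bookkeeping] -/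
def boxTerm (e : BoxPt) : ℚ := (piHi * e.rhi / R.dlo) ^ R.μ * (e.s * expUB e.N (R.ylo e) * ladderQ R.μ (R.ylo e))

/-- The checks of a box witness against its point. -/
def ptOK (z : ℤ × ℤ) (e : BoxPt) : Bool :=
  decide (0 < e.rlo) && decide (e.rlo ≤ e.rhi) && decide (e.rlo ^ 2 * R.Dhi ≤ R.Qlo z) && decide (R.Qhi z ≤ e.rhi ^ 2 * R.Dlo) &&
    decide ((e.N : ℚ) ≤ R.ylo e) && decide (0 ≤ e.s) && decide (piHi / (2 * R.ylo e) ≤ e.s ^ 2)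

/-- Witness lookup. -/
def find (z : ℤ × ℤ) : Option BoxPt := R.pts.find? fun e => decide (e.z0 = z.1 ∧ e.z1 = z.2)

/-- Tail data: `β = 2π⁻ dlo κ`, `y₁ = β (Z+1)`, `δ = 1 − μ/y₁`, and the (clipped) tail constant
`(2 dlo²)^{−μ} · stail · ladder μ y₁ · y₁^μ · expUB Ntail y₁`. -/
def β : ℚ := 2 * piLo * R.dlo * R.κ
/-- `y₁` (docstring added by the landing lane; see the module docstring). [formal bookkeeping] -/
def y₁ : ℚ := R.β * ((R.Z : ℚ) + 1)
/-- `δ` (docstring added by the landing lane; see the module docstring). [formal bookkeeping] -/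
def δ : ℚ := 1 - (R.μ : ℚ) / R.y₁
/-- `tailC` (docstring added by the landing lane; see the module docstring). [formal bookkeeping] -/
def tailC : ℚ := max 0 ((1 / (2 * R.dlo ^ 2)) ^ R.μ * (R.stail * ladderQ R.μ R.y₁ * R.y₁ ^ R.μ * expUB R.Ntail R.y₁))

/-- THE MAJORANT on `ℤ²`: `0` at the origin, the clipped box term inside `[−Z, Z]²`, the separable tail outside. -/
def GQ (z : ℤ × ℤ) : ℚ :=
  if z = 0 then 0
  else if |z.1| ≤ (R.Z : ℤ) ∧ |z.2| ≤ (R.Z : ℤ) then (match R.find z with | some e => max 0 (R.boxTerm e) | none => 0)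
  else R.tailC * 2 ^ (R.Z + 1) * (1 / 2) ^ (z.1.natAbs + z.2.natAbs)

/-- `boxSum` (docstring added by the landing lane; see the module docstring). [formal bookkeeping] -/
def boxSum : ℚ := ((boxPts R.Z).map R.GQ).sum

/-- ★ The certificate check of a row. -/
def check : Bool :=
  decide (1 ≤ R.μ) && decide (0 < R.dlo) && decide (0 < R.g00lo) && decide (0 < R.g11lo) && decide (R.g00lo ≤ R.g00hi) &&
    decide (R.g01lo ≤ R.g01hi) && decide (R.g11lo ≤ R.g11hi) && decide (0 < R.Dlo) &&
    (boxPts R.Z).all (fun z => decide (z = 0) || (match R.find z with | some e => R.ptOK z e | none => false)) &&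
    decide (R.g00hi + R.g11hi ≤ R.Thi) && decide (0 < R.κ) && decide (R.κ ^ 2 * (2 * R.Thi) ≤ 1) &&
    decide ((R.μ : ℚ) < R.y₁) && decide ((R.Ntail : ℚ) ≤ R.y₁) && decide (0 ≤ R.stail) && decide (piHi / (2 * R.y₁) ≤ R.stail ^ 2) &&
    decide ((R.Nrho : ℚ) ≤ R.δ * R.β) && decide (expUB R.Nrho (R.δ * R.β) ≤ 1 / 2) &&
    decide (R.boxSum + R.tailC * 2 ^ (R.Z + 1) * 9 ≤ R.bound)

end DualRow

/-! ## §K6 SOUNDNESS of the dual Bessel kernel -/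

section Sound

variable {V : Type*} [NormedAddCommGroup V] [InnerProductSpace ℝ V]

/-- Interval helper `min_mul_le_mul` — PRIVATE copy (public twin: `Literature.Analysis.FluidPDE.PlanarKinematics.StepQ.min_le_mul`, not imported into this chain; dedup gate p850483). [formal bookkeeping] -/
private theorem min_mul_le_mul {c lo hi x : ℝ} (hlo : lo ≤ x) (hhi : x ≤ hi) : min (c * lo) (c * hi) ≤ c * x := by
  rcases le_total 0 c with hc | hc
  · exact (min_le_left _ _).trans (mul_le_mul_of_nonneg_left hlo hc)
  · exact (min_le_right _ _).trans (mul_le_mul_of_nonpos_left hhi hc)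

/-- Interval helper `mul_le_max_mul` — PRIVATE copy (public twin: `Literature.Analysis.FluidPDE.PlanarKinematics.StepQ.mul_le_max`, not imported into this chain; dedup gate p850483). [formal bookkeeping] -/
private theorem mul_le_max_mul {c lo hi x : ℝ} (hlo : lo ≤ x) (hhi : x ≤ hi) : c * x ≤ max (c * lo) (c * hi) := by
  rcases le_total 0 c with hc | hc
  · exact (mul_le_mul_of_nonneg_left hhi hc).trans (le_max_right _ _)
  · exact (mul_le_mul_of_nonpos_left hlo hc).trans (le_max_left _ _)

/-- Interval helper `sq_le_max_sq` — PRIVATE copy (public twin: `…LoopTunnelDialForcePricing.sq_le_max_sq`, not imported into this chain; dedup gate p850483). [formal bookkeeping] -/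
private theorem sq_le_max_sq {lo hi x : ℝ} (hlo : lo ≤ x) (hhi : x ≤ hi) : x ^ 2 ≤ max (lo ^ 2) (hi ^ 2) := by
  rcases le_total 0 x with hx | hx
  · exact (pow_le_pow_left₀ hx hhi 2).trans (le_max_right _ _)
  · exact le_trans (by nlinarith) (le_max_left _ _)

/-- The geometric series over `ℤ`: `Σ_t (1/2)^{|t|} = 3`. [folklore] -/
theorem hasSum_half_pow_natAbs : HasSum (fun t : ℤ => (1 / 2 : ℝ) ^ t.natAbs) 3 := by
  have hg : HasSum (fun n : ℕ => (1 / 2 : ℝ) ^ n) 2 := by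
    have := hasSum_geometric_of_lt_one (r := (1 / 2 : ℝ)) (by norm_num) (by norm_num)
    rwa [show ((1 : ℝ) - 1 / 2)⁻¹ = 2 by norm_num] at this
  have h1 : HasSum (fun n : ℕ => (1 / 2 : ℝ) ^ (n : ℤ).natAbs) 2 := by
    have : (fun n : ℕ => (1 / 2 : ℝ) ^ (n : ℤ).natAbs) = fun n : ℕ => (1 / 2 : ℝ) ^ n := by
      funext n; rw [Int.natAbs_natCast]
    rw [this]; exact hg
  have h2 : HasSum (fun n : ℕ => (1 / 2 : ℝ) ^ (-((n : ℤ) + 1)).natAbs) 1 := by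
    have : (fun n : ℕ => (1 / 2 : ℝ) ^ (-((n : ℤ) + 1)).natAbs) = fun n : ℕ => (1 / 2 : ℝ) ^ n * (1 / 2) := by
      funext n
      have hn : (-((n : ℤ) + 1)).natAbs = n + 1 := by omega
      rw [hn, pow_succ]
    rw [this]
    have h := hg.mul_right (1 / 2 : ℝ)
    rwa [show (2 : ℝ) * (1 / 2) = 1 by norm_num] at h
  have h := HasSum.of_nat_of_neg_add_one (f := fun t : ℤ => (1 / 2 : ℝ) ^ t.natAbs) h1 h2
  rwa [show (2 : ℝ) + 1 = 3 by norm_num] at h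

/-- `summable_half_pow_natAbs` (docstring added by the landing lane; see the module docstring). [formal bookkeeping] -/
theorem summable_half_pow_natAbs : Summable (fun t : ℤ => (1 / 2 : ℝ) ^ t.natAbs) := hasSum_half_pow_natAbs.summable

/-- `summable_half_pow_pair` (docstring added by the landing lane; see the module docstring). [formal bookkeeping] -/
theorem summable_half_pow_pair : Summable (fun z : ℤ × ℤ => (1 / 2 : ℝ) ^ z.1.natAbs * (1 / 2 : ℝ) ^ z.2.natAbs) :=
  summable_half_pow_natAbs.mul_of_nonneg summable_half_pow_natAbs (fun _ => by positivity) (fun _ => by positivity)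

/-- `hasSum_half_pow_pair` (docstring added by the landing lane; see the module docstring). [formal bookkeeping] -/
theorem hasSum_half_pow_pair : HasSum (fun z : ℤ × ℤ => (1 / 2 : ℝ) ^ z.1.natAbs * (1 / 2 : ℝ) ^ z.2.natAbs) 9 := by
  have h := hasSum_half_pow_natAbs.mul hasSum_half_pow_natAbs summable_half_pow_pair
  rwa [show (3 : ℝ) * 3 = 9 by norm_num] at h

/-- `cast_list_sum_map` (docstring added by the landing lane; see the module docstring). [formal bookkeeping] -/
theorem cast_list_sum_map {ι : Type*} (l : List ι) (f : ι → ℚ) : (((l.map f).sum : ℚ) : ℝ) = (l.map fun i => ((f i : ℚ) : ℝ)).sum := by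
  rw [Rat.cast_list_sum, List.map_map]; rfl

end Sound

end Summit.AtomisticToContinuum.Crystallization.Theorems.OverbindingBudgetAffineFarSmoothSplit

end
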